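import Summits.HodgeConjecture.HodgeConjecture.Theses.TropicalKugaSatakeCayley

/-!
# `EffectiveCayleyNonRealizability` (stmt-HodgeConjecture-18569) · Negative · false pointwise

Negative knowledge for the crux `TropicalKugaSatakeCayley.EffectiveCayleyNonRealizability` (K1):
the hypothesis that the parameter set `U` is OPEN and non-empty is load-bearing —
`effectiveCayleyNonRealizability_false_without_isOpen`: the POINTWISE variant of K1 (one parameter
`t ∈ ksPosCone` instead of a non-empty open `U ⊆ ksPosCone`) is false.

Witness: `t₀ = e₀`, where `ksMatrix e₀ = ksForm 0 = diag(2,4,4,8,4,8,8,16)`; the 2-subtorus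
`ℝ⟨e₁,e₂⟩ / (4ℤe₁ ⊕ 4ℤe₂)` of `ℝ⁸ / B_{e₀}ℤ⁸`, triangulated by the framed triangles
`(0, 4e₁, 4e₁+4e₂)`, `(0, 4e₁+4e₂, 4e₂)` (direction frame `(e₁ e₂)`, weight `1`), is an effective
framed simplicial 2-cycle (the six faces cancel in pairs modulo the periods `4e₁ = B e₁`,
`4e₂ = B e₂`) whose period class `compound 2 B⁻¹ · Z.classOf` has entry `0` at `({0,1},{0,1})` and
`1` at `({1,2},{1,2})`, so it is no multiple of `1 = [θ⁶]`.  Hence a proof of K1 must use the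
interior of `U` (at rational parameters sub-tori abound); the construction also certifies that the
chain encoding of `Literature.AlgebraicGeometry.Tropical.TropicalTorusWeilCycles` carries genuine
effective cycles with off-theta classes (refuter crux-attack, 2026-08-17).  [folklore]
-/

noncomputable section

-- The mandated namespace repeats `HodgeConjecture` (single-conjunct summit).
set_option linter.dupNamespace false

namespace Summit.HodgeConjecture.HodgeConjecture.Theorems.EffectiveCayleyNonRealizability.Negative.PointwiseFalse

open Literature.AlgebraicGeometry.Tropical
open Literature.AlgebraicGeometry.Tropical.TropicalTorus

/-! ### The special parameter `t₀ = e₀` and its period matrix -/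

/-- The parameter `e₀ = (1,0,0,0,0)`. -/
def t₀ : Fin 5 → ℝ := fun i => if i = 0 then 1 else 0

/-- The diagonal of `ksForm 0`, as reals. -/
def dR : Fin 8 → ℝ := fun i => ((![2, 4, 4, 8, 4, 8, 8, 16] : Fin 8 → ℤ) i : ℝ)

/-- Its pointwise inverse. -/
def dInv : Fin 8 → ℝ := fun i => (dR i)⁻¹

/-- The diagonal is positive. -/
theorem dR_pos (i : Fin 8) : 0 < dR i := by
  fin_cases i <;> simp [dR]

/-- `B_{e₀} = diag(2,4,4,8,4,8,8,16)`. -/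
theorem ksMatrix_t₀ : ksMatrix t₀ = Matrix.diagonal dR := by
  unfold ksMatrix
  rw [Fin.sum_univ_five, show t₀ 0 = 1 by simp [t₀], show t₀ 1 = 0 by simp [t₀],
    show t₀ 2 = 0 by simp [t₀], show t₀ 3 = 0 by simp [t₀], show t₀ 4 = 0 by simp [t₀]]
  simp only [one_smul, zero_smul, add_zero]
  rw [show ksForm 0 = ksBase from rfl, ksBase, Matrix.diagonal_map (Int.cast_zero)]
  rfl

/-- `e₀` lies in the positive cone. -/
theorem t₀_mem : t₀ ∈ ksPosCone := by
  show (ksMatrix t₀).PosDef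
  rw [ksMatrix_t₀]
  exact Matrix.PosDef.diagonal (fun i => dR_pos i)

/-- `B_{e₀}⁻¹`. -/
theorem inv_ksMatrix_t₀ : (ksMatrix t₀)⁻¹ = Matrix.diagonal dInv := by
  rw [ksMatrix_t₀]
  refine Matrix.inv_eq_left_inv ?_
  rw [Matrix.diagonal_mul_diagonal]
  have : (fun i => dInv i * dR i) = fun _ => (1 : ℝ) := by
    funext i; simp [dInv, (dR_pos i).ne']
  rw [this]; rfl

/-! ### The witness chain -/

/-- Direction frame with columns `e₁, e₂`. -/
def DA : Matrix (Fin 8) (Fin 2) ℚ := !![0, 0; 1, 0; 0, 1; 0, 0; 0, 0; 0, 0; 0, 0; 0, 0]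

/-- First triangle `(0, 4e₁, 4e₁ + 4e₂)`. -/
def cellA : Cell ℝ 8 2 := ⟨0, DA, !![4, 0; 4, 4], 1⟩

/-- Second triangle `(0, 4e₁ + 4e₂, 4e₂)`. -/
def cellB : Cell ℝ 8 2 := ⟨0, DA, !![4, 4; 0, 4], 1⟩

/-- The two-triangle fundamental cycle of the sub-torus `ℝ⟨e₁,e₂⟩/(4ℤe₁ ⊕ 4ℤe₂)`. -/
def Z : Chain ℝ 8 2 := ⟨2, ![cellA, cellB]⟩

/-- `det coef = 16` for the first triangle. -/
theorem detA : cellA.coef.det = 16 := by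
  simp [cellA, Matrix.det_fin_two]; norm_num
/-- `det coef = 16` for the second triangle. -/
theorem detB : cellB.coef.det = 16 := by
  simp [cellB, Matrix.det_fin_two]; norm_num

/-- Both triangles are positively oriented with weight `1`. -/
theorem Z_effective : Z.Effective := by
  intro c
  fin_cases c
  · show 0 < (cellA.weight : ℝ) * cellA.coef.det
    rw [detA]; simp [cellA]
  · show 0 < (cellB.weight : ℝ) * cellB.coef.det
    rw [detB]; simp [cellB]

/-- Both triangles carry the same framing `1 • e₁∧e₂`. -/
theorem framingB : cellB.framing = cellA.framing := rfl

/-- `0 < 2`. -/ theorem zero_lt_Z : 0 < Z.size := by decide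
/-- `1 < 2`. -/ theorem one_lt_Z : 1 < Z.size := by decide
/-- Cell `0` of `Z`. -/ theorem Z_cell_zero : Z.cell ⟨0, zero_lt_Z⟩ = cellA := rfl
/-- Cell `1` of `Z`. -/ theorem Z_cell_one : Z.cell ⟨1, one_lt_Z⟩ = cellB := rfl

/-- Sums over the two cells of `Z`. -/
theorem sum_fin_Z {β : Type*} [AddCommMonoid β] (f : Fin Z.size → β) :
    ∑ c, f c = f ⟨0, zero_lt_Z⟩ + f ⟨1, one_lt_Z⟩ :=
  Fin.sum_univ_two f

/-! ### Vertices and faces -/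

/-- `0`. -/
def v0 : Fin 8 → ℝ := ![0, 0, 0, 0, 0, 0, 0, 0]
/-- `4e₁`. -/
def v1 : Fin 8 → ℝ := ![0, 4, 0, 0, 0, 0, 0, 0]
/-- `4e₂`. -/
def v2 : Fin 8 → ℝ := ![0, 0, 4, 0, 0, 0, 0, 0]
/-- `4e₁ + 4e₂`. -/
def v12 : Fin 8 → ℝ := ![0, 4, 4, 0, 0, 0, 0, 0]

/-- Vertex `0` of the first triangle. -/
theorem vertexA0 : cellA.vertex 0 = v0 := by
  show cellA.base = v0
  funext r; fin_cases r <;> simp [cellA, v0]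
/-- Vertex `4e₁` of the first triangle. -/
theorem vertexA1 : cellA.vertex 1 = v1 := by
  show cellA.base + cellA.edge 0 = v1
  funext r; fin_cases r <;> simp [cellA, Cell.edge, DA, v1, Fin.sum_univ_two]
/-- Vertex `4e₁ + 4e₂` of the first triangle. -/
theorem vertexA2 : cellA.vertex 2 = v12 := by
  show cellA.base + cellA.edge 1 = v12
  funext r; fin_cases r <;> simp [cellA, Cell.edge, DA, v12, Fin.sum_univ_two]
/-- Vertex `0` of the second triangle. -/
theorem vertexB0 : cellB.vertex 0 = v0 := by
  show cellB.base = v0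
  funext r; fin_cases r <;> simp [cellB, v0]
/-- Vertex `4e₁ + 4e₂` of the second triangle. -/
theorem vertexB1 : cellB.vertex 1 = v12 := by
  show cellB.base + cellB.edge 0 = v12
  funext r; fin_cases r <;> simp [cellB, Cell.edge, DA, v12, Fin.sum_univ_two]
/-- Vertex `4e₂` of the second triangle. -/
theorem vertexB2 : cellB.vertex 2 = v2 := by
  show cellB.base + cellB.edge 1 = v2
  funext r; fin_cases r <;> simp [cellB, Cell.edge, DA, v2, Fin.sum_univ_two]

/-- The three faces of a 2-cell as ordered vertex pairs. -/
theorem faces (c : Cell ℝ 8 2) :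
    c.face 0 = ![c.vertex 1, c.vertex 2] ∧ c.face 1 = ![c.vertex 0, c.vertex 2] ∧
      c.face 2 = ![c.vertex 0, c.vertex 1] := by
  refine ⟨?_, ?_, ?_⟩ <;> funext j <;> fin_cases j <;> rfl

/-! ### Period translates -/

/-- Translating an ordered tuple by a period does not change the tuples it is a translate of. -/
theorem isTranslate_iff_of_shift {p : ℕ} (Per : Matrix (Fin 8) (Fin 8) ℝ)
    (τ σ σ' : Fin p → Fin 8 → ℝ) (k₀ : Fin 8 → ℤ)
    (h : ∀ j, σ' j = σ j + Per.mulVec (fun r => (k₀ r : ℝ))) :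
    IsTranslate Per τ σ' ↔ IsTranslate Per τ σ := by
  constructor
  · rintro ⟨k, hk⟩
    refine ⟨k - k₀, fun j => ?_⟩
    have hj := hk j
    rw [h j] at hj
    have e : (fun r => ((k - k₀) r : ℝ)) = (fun r => (k r : ℝ)) - (fun r => (k₀ r : ℝ)) := by
      funext r; simp
    rw [e, Matrix.mulVec_sub]
    linear_combination hj
  · rintro ⟨k, hk⟩
    refine ⟨k + k₀, fun j => ?_⟩
    rw [h j, hk j]
    have e : (fun r => ((k + k₀) r : ℝ)) = (fun r => (k r : ℝ)) + (fun r => (k₀ r : ℝ)) := by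
      funext r; simp
    rw [e, Matrix.mulVec_add]
    abel

/-- `e₁` as an integer vector. -/
def k₁ : Fin 8 → ℤ := ![0, 1, 0, 0, 0, 0, 0, 0]
/-- `e₂` as an integer vector. -/
def k₂ : Fin 8 → ℤ := ![0, 0, 1, 0, 0, 0, 0, 0]

/-- The period `B e₁ = 4e₁`. -/
theorem per_k₁ : (Matrix.diagonal dR).mulVec (fun r => (k₁ r : ℝ)) = v1 := by
  funext r; fin_cases r <;> simp [Matrix.mulVec_diagonal, dR, k₁, v1]
/-- The period `B e₂ = 4e₂`. -/
theorem per_k₂ : (Matrix.diagonal dR).mulVec (fun r => (k₂ r : ℝ)) = v2 := by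
  funext r; fin_cases r <;> simp [Matrix.mulVec_diagonal, dR, k₂, v2]

variable (τ : Fin 2 → Fin 8 → ℝ)

/-- Face `(4e₁, 4e₁+4e₂)` of A is face `(0, 4e₂)` of B shifted by the period `4e₁`. -/
theorem cond₁ : IsTranslate (Matrix.diagonal dR) τ ![v1, v12] ↔
    IsTranslate (Matrix.diagonal dR) τ ![v0, v2] :=
  isTranslate_iff_of_shift _ τ _ _ k₁ fun j => by
    rw [per_k₁]; fin_cases j <;> (funext r; fin_cases r <;> simp [v0, v1, v2, v12])
/-- The same, with reversed vertex order. -/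
theorem cond₁' : IsTranslate (Matrix.diagonal dR) τ ![v12, v1] ↔
    IsTranslate (Matrix.diagonal dR) τ ![v2, v0] :=
  isTranslate_iff_of_shift _ τ _ _ k₁ fun j => by
    rw [per_k₁]; fin_cases j <;> (funext r; fin_cases r <;> simp [v0, v1, v2, v12])
/-- Face `(4e₁+4e₂, 4e₂)` of B is face `(4e₁, 0)` of A shifted by the period `4e₂`. -/
theorem cond₂ : IsTranslate (Matrix.diagonal dR) τ ![v12, v2] ↔
    IsTranslate (Matrix.diagonal dR) τ ![v1, v0] :=
  isTranslate_iff_of_shift _ τ _ _ k₂ fun j => by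
    rw [per_k₂]; fin_cases j <;> (funext r; fin_cases r <;> simp [v0, v1, v2, v12])
/-- The same, with reversed vertex order. -/
theorem cond₂' : IsTranslate (Matrix.diagonal dR) τ ![v2, v12] ↔
    IsTranslate (Matrix.diagonal dR) τ ![v0, v1] :=
  isTranslate_iff_of_shift _ τ _ _ k₂ fun j => by
    rw [per_k₂]; fin_cases j <;> (funext r; fin_cases r <;> simp [v0, v1, v2, v12])

/-! ### The cycle condition -/

/-- Sums over `Perm (Fin 2) = {1, swap 0 1}`. -/
theorem sum_perm_fin_two {β : Type*} [AddCommMonoid β] (f : Equiv.Perm (Fin 2) → β) :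
    ∑ π, f π = f 1 + f (Equiv.swap 0 1) := by
  rw [show (Finset.univ : Finset (Equiv.Perm (Fin 2))) = {1, Equiv.swap 0 1} by decide,
    Finset.sum_pair (by decide)]
/-- Sums over `Fin (2+1)` (the face index). -/
theorem sum_fin_three {β : Type*} [AddCommMonoid β] (f : Fin (2 + 1) → β) :
    ∑ i, f i = f 0 + f 1 + f 2 :=
  Fin.sum_univ_three f
/-- Reordering a pair by `1`. -/
theorem vec2_comp_one {α : Type*} (a b : α) :
    (![a, b] ∘ ⇑(1 : Equiv.Perm (Fin 2))) = ![a, b] := by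
  funext j; fin_cases j <;> simp
/-- Reordering a pair by `swap 0 1`. -/
theorem vec2_comp_swap {α : Type*} (a b : α) :
    (![a, b] ∘ ⇑(Equiv.swap (0 : Fin 2) 1)) = ![b, a] := by
  funext j; fin_cases j <;> simp [Equiv.swap_apply_left, Equiv.swap_apply_right]
/-- `sign (swap 0 1) = -1`. -/
theorem sign_swap01 : ((Equiv.Perm.sign (Equiv.swap (0 : Fin 2) 1) : ℤˣ) : ℤ) = -1 := by
  rw [Equiv.Perm.sign_swap (by decide)]; rfl
/-- Pull a negation out of `if … then -a else 0`. -/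
theorem ite_neg_zero {β : Type*} [AddGroup β] (c : Prop) [Decidable c] (a : β) :
    (if c then -a else (0 : β)) = -(if c then a else 0) := by
  split_ifs <;> simp

open Classical in
/-- `Z` is a cycle for the period lattice `B_{e₀}ℤ⁸`: its six faces cancel in pairs. -/
theorem Z_isCycle : Z.IsCycle (Matrix.diagonal dR) := by
  intro τ
  unfold Chain.boundaryCoeff
  rw [sum_fin_Z]
  simp only [Z_cell_zero, Z_cell_one, sum_fin_three, sum_perm_fin_two, (faces cellA).1,
    (faces cellA).2.1, (faces cellA).2.2, (faces cellB).1, (faces cellB).2.1, (faces cellB).2.2,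
    vertexA0, vertexA1, vertexA2, vertexB0, vertexB1, vertexB2,
    vec2_comp_one, vec2_comp_swap, Equiv.Perm.sign_one, Units.val_one,
    sign_swap01, framingB, cond₁, cond₁', cond₂, cond₂', Fin.val_zero, Fin.val_one, Fin.val_two,
    pow_zero, pow_one, neg_one_sq, mul_one, one_mul, mul_neg, neg_neg, Int.cast_one, Int.cast_neg,
    one_smul, neg_smul, ite_neg_zero]
  abel

/-! ### Two entries of the period class -/

/-- `{1,2}`. -/
def ω : Sub 8 2 := ⟨{1, 2}, by decide⟩
/-- `{0,1}`. -/
def ω' : Sub 8 2 := ⟨{0, 1}, by decide⟩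

/-- The increasing enumeration of a pair `{a < b}`. -/
theorem emb_pair {a b : Fin 8} (hab : a < b) (h : ({a, b} : Finset (Fin 8)).card = 2) :
    (Finset.orderEmbOfFin {a, b} h 0 : Fin 8) = a ∧ (Finset.orderEmbOfFin {a, b} h 1 : Fin 8) = b := by
  have hm0 : Finset.orderEmbOfFin {a, b} h 0 ∈ ({a, b} : Finset (Fin 8)) :=
    Finset.orderEmbOfFin_mem _ _ 0
  have hm1 : Finset.orderEmbOfFin {a, b} h 1 ∈ ({a, b} : Finset (Fin 8)) :=
    Finset.orderEmbOfFin_mem _ _ 1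
  have hlt : Finset.orderEmbOfFin {a, b} h 0 < Finset.orderEmbOfFin {a, b} h 1 :=
    (Finset.orderEmbOfFin _ h).strictMono (by decide)
  simp only [Finset.mem_insert, Finset.mem_singleton] at hm0 hm1
  rcases hm0 with h0 | h0 <;> rcases hm1 with h1 | h1 <;> rw [h0, h1] at hlt
  · exact absurd hlt (lt_irrefl _)
  · exact ⟨h0, h1⟩
  · exact absurd (hlt.trans hab) (lt_irrefl _)
  · exact absurd hlt (lt_irrefl _)
/-- `{1,2}` enumerates as `(1,2)`. -/
theorem emb_ω :
    (ω.1.orderEmbOfFin ω.2 0 : Fin 8) = 1 ∧ (ω.1.orderEmbOfFin ω.2 1 : Fin 8) = 2 :=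
  emb_pair (by decide) ω.2
/-- `{0,1}` enumerates as `(0,1)`. -/
theorem emb_ω' :
    (ω'.1.orderEmbOfFin ω'.2 0 : Fin 8) = 0 ∧ (ω'.1.orderEmbOfFin ω'.2 1 : Fin 8) = 1 :=
  emb_pair (by decide) ω'.2

/-- The Plücker coordinate of `(e₁ e₂)` at `{1,2}` is `1`. -/
theorem pluecker_ω : pluecker DA ω = 1 := by
  unfold pluecker
  rw [Matrix.det_fin_two]
  simp only [Matrix.submatrix_apply, id, emb_ω.1, emb_ω.2]
  simp [DA]
/-- The Plücker coordinate of `(e₁ e₂)` at `{0,1}` is `0`. -/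
theorem pluecker_ω' : pluecker DA ω' = 0 := by
  unfold pluecker
  rw [Matrix.det_fin_two]
  simp only [Matrix.submatrix_apply, id, emb_ω'.1, emb_ω'.2]
  simp [DA]

/-- Off-diagonal minors of a diagonal matrix vanish. -/
theorem minor_diagonal_of_ne {g p : ℕ} (w : Fin g → ℝ) (K L : Sub g p) (h : K ≠ L) :
    minor (Matrix.diagonal w) K L = 0 := by
  have hKL : ¬ (K.1 ⊆ L.1) := by
    intro hsub
    exact h (Subtype.ext (Finset.eq_of_subset_of_card_le hsub (by rw [K.2, L.2])))
  rw [Finset.not_subset] at hKL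
  obtain ⟨k, hkK, hkL⟩ := hKL
  have hk : k ∈ Set.range (K.1.orderEmbOfFin K.2) := by
    rw [Finset.range_orderEmbOfFin]; exact hkK
  obtain ⟨i, hi⟩ := hk
  unfold minor
  apply Matrix.det_eq_zero_of_row_eq_zero i
  intro j
  simp only [Matrix.submatrix_apply, Matrix.diagonal_apply]
  rw [if_neg]
  intro heq
  apply hkL
  rw [← hi, heq]
  exact Finset.orderEmbOfFin_mem L.1 L.2 j

/-- The `({1,2},{1,2})` minor of `B⁻¹`. -/
theorem minor_ωω : minor (Matrix.diagonal dInv) ω ω = dInv 1 * dInv 2 := by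
  unfold minor
  rw [Matrix.det_fin_two]
  simp only [Matrix.submatrix_apply, emb_ω.1, emb_ω.2, Matrix.diagonal_apply_eq]
  rw [Matrix.diagonal_apply_ne _ (by decide), Matrix.diagonal_apply_ne _ (by decide)]
  ring

/-- Column `{0,1}` of `Z.classOf` vanishes. -/
theorem classOf_ω' (L : Sub 8 2) : Z.classOf L ω' = 0 := by
  unfold Chain.classOf
  rw [sum_fin_Z]
  simp only [Z_cell_zero, Z_cell_one, Matrix.add_apply, Cell.classOf, Matrix.of_apply, Cell.framing]
  rw [show cellA.dir = DA from rfl, show cellB.dir = DA from rfl, pluecker_ω']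
  simp

/-- `Z.classOf ({1,2},{1,2}) = 16`. -/
theorem classOf_ωω : Z.classOf ω ω = 16 := by
  unfold Chain.classOf
  rw [sum_fin_Z]
  simp only [Z_cell_zero, Z_cell_one, Matrix.add_apply, Cell.classOf, Matrix.of_apply, Cell.framing]
  rw [show cellA.dir = DA from rfl, show cellB.dir = DA from rfl, show cellA.weight = 1 from rfl,
    show cellB.weight = 1 from rfl, pluecker_ω, detA, detB]
  norm_num [Nat.factorial]

/-- The period class of `Z` vanishes at `({0,1},{0,1})` … -/
theorem entry_ω' : (compound 2 (Matrix.diagonal dInv) * Z.classOf) ω' ω' = 0 := by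
  rw [Matrix.mul_apply]
  simp [classOf_ω']

/-- … and equals `1` at `({1,2},{1,2})`. -/
theorem entry_ω : (compound 2 (Matrix.diagonal dInv) * Z.classOf) ω ω = 1 := by
  rw [Matrix.mul_apply, Finset.sum_eq_single ω]
  · simp only [compound, Matrix.of_apply]
    rw [minor_ωω, classOf_ωω]
    simp [dInv, dR]; norm_num
  · intro L _ hL
    simp only [compound, Matrix.of_apply]
    rw [minor_diagonal_of_ne _ _ _ (Ne.symm hL), zero_mul]
  · intro h; exact absurd (Finset.mem_univ ω) h

/-! ### The pointwise variant of K1 is false -/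

/-- **K1 pointwise is false** (`IsOpen U` / non-empty interior is load-bearing in
`EffectiveCayleyNonRealizability`): at the single parameter `t₀ = e₀ ∈ ksPosCone` there is an
effective framed simplicial 2-cycle of `ℝ⁸/B_{e₀}ℤ⁸` whose period class is not a multiple of
`1 = [θ⁶]` (it is the class of the 2-subtorus `ℝ⟨e₁,e₂⟩/(4ℤe₁ ⊕ 4ℤe₂)`). [folklore] -/
theorem effectiveCayleyNonRealizability_false_without_isOpen :
    ¬ (∀ t ∈ ksPosCone, ∀ M : Matrix (Sub 8 2) (Sub 8 2) ℝ,
        (∃ Z : Chain ℝ 8 2, Z.IsCycle (ksMatrix t) ∧ Z.Effective ∧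
          compound 2 (ksMatrix t)⁻¹ * Z.classOf = M) →
        ∃ r : ℝ, M = r • (1 : Matrix (Sub 8 2) (Sub 8 2) ℝ)) := by
  intro h
  obtain ⟨r, hr⟩ := h t₀ t₀_mem _ ⟨Z, by rw [ksMatrix_t₀]; exact Z_isCycle, Z_effective, rfl⟩
  rw [inv_ksMatrix_t₀] at hr
  have h1 := congrFun (congrFun hr ω') ω'
  have h2 := congrFun (congrFun hr ω) ω
  rw [entry_ω'] at h1
  rw [entry_ω] at h2
  simp only [Matrix.smul_apply, Matrix.one_apply_eq, smul_eq_mul, mul_one] at h1 h2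
  rw [← h1] at h2
  exact one_ne_zero h2

end Summit.HodgeConjecture.HodgeConjecture.Theorems.EffectiveCayleyNonRealizability.Negative.PointwiseFalse

end
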